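import Summits.NavierStokesRegularity.OSWSelfSimilar.SheetRCayleySubstitution
import HarnessLib

/-!
# SHEET-ℝ frame, item (E3) companion: the backbone `B₀ = 1 + ½ξ∂ − ∂²` is BANDED-EXACT in the Cayley frame

HONEST FRAMING (cell ns-blowup GROUP B / zone Z3, case Z3-SR-CERT; 1-D MODEL certificate frame; not Euler/NS; «violates: none — MODEL»).

The local part of the certificate's linearisation is the similarity backbone `B₀δ = δ + ½ξδ′ − δ″` (kernel energy identity:
`SheetLineBackbone.backbone_energy_identity`). cert-1's price memo (`SHEET-R-PRICE-impl1.md` §1 (E3)) records that in the frame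
`e_n(ξ) = (1 + cos θ)·sin nθ`, `θ = 2·arctan(ξ/L)`, the backbone is BANDED and EXACT: `B₀e_n ∈ span{e_m : |m − n| ≤ 2}` with rational entries —
the structure the interval stage (T1/T3/T4) uses to apply `B_λ` to trigonometric series in closed form. This file is the kernel form:

  `B₀e_n = (n+1)(n+2)/(4L²)·e_{n+2} + (n+1)(¼ + (2n+1)/(2L²))·e_{n+1} + (½ + 3n²/(2L²))·e_n`
          `+ (n−1)(−¼ + (2n−1)/(2L²))·e_{n−1} + (n−1)(n−2)/(4L²)·e_{n−2}`        (`backbone_frame`)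

for every `n : ℕ`, `L ≠ 0`, at every `ξ` (with `e_m` for the real indices `n − 1`, `n − 2` written as `(1 + cos θ)·sin((n−1)θ)` etc.; for `n = 1`
the last two coefficients vanish). Mechanism: `θ′ = 2L/(L² + ξ²) = (1 + cos θ)/L`, `ξ = L sin θ/(1 + cos θ)`, so `½ξ∂_ξ = ½ sin θ ∂_θ` and
`∂_ξ² = L⁻²(1 + cos θ)∂_θ((1 + cos θ)∂_θ)`; everything is a product of `sin nθ`, `cos nθ` with rational functions of `ξ`, and the identity is
checked as two rational identities (coefficients of `sin nθ` and `cos nθ`). Along the way the first two `ξ`-derivatives of `e_n` in closed form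
(`hasDerivAt_frame`, `hasDerivAt_frame_deriv`, `deriv_frame`, `iteratedDeriv_two_frame`). Pure calculus; no definition, no named fact.
-/

noncomputable section

namespace Summit.NavierStokesRegularity.OSWSelfSimilar
namespace SheetRBackboneFrame

open _root_.Set _root_.Filter _root_.Real SheetRCayleySubstitution
open scoped Real Topology

/-- `L² + ξ² ≠ 0` for `L ≠ 0`. [folklore] -/
private theorem w_ne {L : ℝ} (hL : L ≠ 0) (ξ : ℝ) : L ^ 2 + ξ ^ 2 ≠ 0 := by positivity

/-- `d/dξ sin(nθ(ξ)) = 2nL·cos(nθ)/(L² + ξ²)`. [folklore] -/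
theorem hasDerivAt_sin_mul_cayleyAngle {L : ℝ} (hL : L ≠ 0) (c ξ : ℝ) :
    HasDerivAt (fun ξ : ℝ => sin (c * (2 * arctan (ξ / L))))
      (2 * c * L * cos (c * (2 * arctan (ξ / L))) / (L ^ 2 + ξ ^ 2)) ξ := by
  have h := ((hasDerivAt_cayleyAngle hL ξ).const_mul c).sin
  refine h.congr_deriv ?_
  have := w_ne hL ξ
  field_simp

/-- `d/dξ cos(nθ(ξ)) = −2nL·sin(nθ)/(L² + ξ²)`. [folklore] -/
theorem hasDerivAt_cos_mul_cayleyAngle {L : ℝ} (hL : L ≠ 0) (c ξ : ℝ) :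
    HasDerivAt (fun ξ : ℝ => cos (c * (2 * arctan (ξ / L))))
      (-(2 * c * L * sin (c * (2 * arctan (ξ / L))) / (L ^ 2 + ξ ^ 2))) ξ := by
  have h := ((hasDerivAt_cayleyAngle hL ξ).const_mul c).cos
  refine h.congr_deriv ?_
  have := w_ne hL ξ
  field_simp

/-- **First derivative of the frame function**: `e_n′(ξ) = (−4L²ξ·sin nθ + 4nL³·cos nθ)/(L² + ξ²)²`. [folklore] -/
theorem hasDerivAt_frame {L : ℝ} (hL : L ≠ 0) (n : ℕ) (ξ : ℝ) :
    HasDerivAt (fun ξ : ℝ => (1 + cos (2 * arctan (ξ / L))) * sin (n * (2 * arctan (ξ / L))))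
      ((-(4 * L ^ 2 * ξ) * sin (n * (2 * arctan (ξ / L))) + 4 * n * L ^ 3 * cos (n * (2 * arctan (ξ / L)))) /
        (L ^ 2 + ξ ^ 2) ^ 2) ξ := by
  have h1 : HasDerivAt (fun ξ : ℝ => 1 + cos (2 * arctan (ξ / L)))
      (-sin (2 * arctan (ξ / L)) * (2 * L / (L ^ 2 + ξ ^ 2))) ξ :=
    ((hasDerivAt_cayleyAngle hL ξ).cos).const_add 1
  have h := h1.mul (hasDerivAt_sin_mul_cayleyAngle hL (n : ℝ) ξ)
  refine h.congr_deriv ?_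
  rw [sin_cayleyAngle hL, one_add_cos_cayleyAngle hL]
  have := w_ne hL ξ
  field_simp
  ring

/-- The derivative of `e_n` as a function. [folklore] -/
theorem deriv_frame {L : ℝ} (hL : L ≠ 0) (n : ℕ) :
    deriv (fun ξ : ℝ => (1 + cos (2 * arctan (ξ / L))) * sin (n * (2 * arctan (ξ / L)))) =
      fun ξ => (-(4 * L ^ 2 * ξ) * sin (n * (2 * arctan (ξ / L))) + 4 * n * L ^ 3 * cos (n * (2 * arctan (ξ / L)))) /
        (L ^ 2 + ξ ^ 2) ^ 2 :=
  funext fun ξ => (hasDerivAt_frame hL n ξ).deriv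

/-- **Second derivative of the frame function**: the derivative of `e_n′` in closed form,
`e_n″(ξ) = ((−4L²(L² + ξ²) − 8n²L⁴ + 16L²ξ²)·sin nθ − 24nL³ξ·cos nθ)/(L² + ξ²)³`. [folklore] -/
theorem hasDerivAt_frame_deriv {L : ℝ} (hL : L ≠ 0) (n : ℕ) (ξ : ℝ) :
    HasDerivAt (fun ξ : ℝ => (-(4 * L ^ 2 * ξ) * sin (n * (2 * arctan (ξ / L))) +
        4 * n * L ^ 3 * cos (n * (2 * arctan (ξ / L)))) / (L ^ 2 + ξ ^ 2) ^ 2)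
      (((-(4 * L ^ 2 * (L ^ 2 + ξ ^ 2)) - 8 * n ^ 2 * L ^ 4 + 16 * L ^ 2 * ξ ^ 2) * sin (n * (2 * arctan (ξ / L)))
        - 24 * n * L ^ 3 * ξ * cos (n * (2 * arctan (ξ / L)))) / (L ^ 2 + ξ ^ 2) ^ 3) ξ := by
  have hw := w_ne hL ξ
  have hS := hasDerivAt_sin_mul_cayleyAngle hL (n : ℝ) ξ
  have hC := hasDerivAt_cos_mul_cayleyAngle hL (n : ℝ) ξ
  have hN : HasDerivAt (fun ξ : ℝ => -(4 * L ^ 2 * ξ) * sin (n * (2 * arctan (ξ / L))) +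
      4 * n * L ^ 3 * cos (n * (2 * arctan (ξ / L))))
      (-(4 * L ^ 2 * 1) * sin (n * (2 * arctan (ξ / L))) +
        -(4 * L ^ 2 * ξ) * (2 * n * L * cos (n * (2 * arctan (ξ / L))) / (L ^ 2 + ξ ^ 2)) +
        4 * n * L ^ 3 * -(2 * n * L * sin (n * (2 * arctan (ξ / L))) / (L ^ 2 + ξ ^ 2))) ξ :=
    ((((hasDerivAt_id' ξ).const_mul (4 * L ^ 2)).neg.mul hS).add (hC.const_mul (4 * n * L ^ 3)))
  have hD : HasDerivAt (fun ξ : ℝ => (L ^ 2 + ξ ^ 2) ^ 2) (2 * (L ^ 2 + ξ ^ 2) ^ 1 * (2 * ξ)) ξ := by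
    have h := ((hasDerivAt_pow 2 ξ).const_add (L ^ 2)).fun_pow 2
    refine h.congr_deriv ?_
    push_cast
    ring
  have h := hN.div hD (pow_ne_zero 2 hw)
  refine h.congr_deriv ?_
  field_simp
  ring

/-- The second derivative of `e_n` as a value of `iteratedDeriv 2`. [folklore] -/
theorem iteratedDeriv_two_frame {L : ℝ} (hL : L ≠ 0) (n : ℕ) (ξ : ℝ) :
    iteratedDeriv 2 (fun ξ : ℝ => (1 + cos (2 * arctan (ξ / L))) * sin (n * (2 * arctan (ξ / L)))) ξ =
      ((-(4 * L ^ 2 * (L ^ 2 + ξ ^ 2)) - 8 * n ^ 2 * L ^ 4 + 16 * L ^ 2 * ξ ^ 2) * sin (n * (2 * arctan (ξ / L)))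
        - 24 * n * L ^ 3 * ξ * cos (n * (2 * arctan (ξ / L)))) / (L ^ 2 + ξ ^ 2) ^ 3 := by
  rw [iteratedDeriv_succ, iteratedDeriv_one, deriv_frame hL n]
  exact (hasDerivAt_frame_deriv hL n ξ).deriv

/-- **`B₀ = 1 + ½ξ∂ − ∂²` is BANDED-EXACT in the Cayley frame** (PRICE-impl1 §1 (E3)): for every `n : ℕ`, `L ≠ 0` and `ξ`, with
`θ = 2·arctan(ξ/L)` and `e_m = (1 + cos θ)·sin mθ`,
`B₀e_n = (n+1)(n+2)/(4L²)·e_{n+2} + (n+1)(¼ + (2n+1)/(2L²))·e_{n+1} + (½ + 3n²/(2L²))·e_n + (n−1)(−¼ + (2n−1)/(2L²))·e_{n−1} + (n−1)(n−2)/(4L²)·e_{n−2}`.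
[folklore] -/
theorem backbone_frame {L : ℝ} (hL : L ≠ 0) (n : ℕ) (ξ : ℝ) :
    (fun ξ : ℝ => (1 + cos (2 * arctan (ξ / L))) * sin (n * (2 * arctan (ξ / L)))) ξ +
      ξ / 2 * deriv (fun ξ : ℝ => (1 + cos (2 * arctan (ξ / L))) * sin (n * (2 * arctan (ξ / L)))) ξ -
      iteratedDeriv 2 (fun ξ : ℝ => (1 + cos (2 * arctan (ξ / L))) * sin (n * (2 * arctan (ξ / L)))) ξ =
    (n + 1) * (n + 2) / (4 * L ^ 2) * ((1 + cos (2 * arctan (ξ / L))) * sin ((n + 2) * (2 * arctan (ξ / L)))) +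
    (n + 1) * (1 / 4 + (2 * n + 1) / (2 * L ^ 2)) * ((1 + cos (2 * arctan (ξ / L))) * sin ((n + 1) * (2 * arctan (ξ / L)))) +
    (1 / 2 + 3 * n ^ 2 / (2 * L ^ 2)) * ((1 + cos (2 * arctan (ξ / L))) * sin (n * (2 * arctan (ξ / L)))) +
    (n - 1) * (-(1 / 4) + (2 * n - 1) / (2 * L ^ 2)) * ((1 + cos (2 * arctan (ξ / L))) * sin ((n - 1) * (2 * arctan (ξ / L)))) +
    (n - 1) * (n - 2) / (4 * L ^ 2) * ((1 + cos (2 * arctan (ξ / L))) * sin ((n - 2) * (2 * arctan (ξ / L)))) := by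
  have hw := w_ne hL ξ
  rw [deriv_frame hL n, iteratedDeriv_two_frame hL n]
  simp only
  -- angle addition: everything in terms of `sin nθ`, `cos nθ`, `sin θ`, `cos θ`
  have e2p : ((n : ℝ) + 2) * (2 * arctan (ξ / L)) =
      n * (2 * arctan (ξ / L)) + (2 * arctan (ξ / L) + 2 * arctan (ξ / L)) := by ring
  have e1p : ((n : ℝ) + 1) * (2 * arctan (ξ / L)) = n * (2 * arctan (ξ / L)) + 2 * arctan (ξ / L) := by ring
  have e1m : ((n : ℝ) - 1) * (2 * arctan (ξ / L)) = n * (2 * arctan (ξ / L)) - 2 * arctan (ξ / L) := by ring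
  have e2m : ((n : ℝ) - 2) * (2 * arctan (ξ / L)) =
      n * (2 * arctan (ξ / L)) - (2 * arctan (ξ / L) + 2 * arctan (ξ / L)) := by ring
  rw [e2p, e1p, e1m, e2m]
  simp only [sin_add, cos_add, sin_sub, cos_cayleyAngle hL, sin_cayleyAngle hL]
  field_simp
  ring

end SheetRBackboneFrame
end Summit.NavierStokesRegularity.OSWSelfSimilar
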